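import Mathlib
import Summits.PneNP.PneNP.Theorems.ConvexRankGatesConvexGateBlindCliqueNonnegKernel

/-!
# PneNP / ConvexRankGates — `ConvexGateBlind`: ℓ₁-domination of clique-non-negative edge weightings

Helpers (`--supports stmt-PneNP-10680`), second file of the COLUMN-SPACE line (prover seat 2, session 13), on top of
the kernel identity of `…CliqueNonnegKernel.lean`. For a `k`-clique-non-negative edge weighting `w` of `K_m`
(`w(E(Q)) ≥ 0` on every `k`-set, `4 ≤ k`, `k + 2 ≤ m`):

* `sum_johnsonCoeff_eq_one` — the uniform weighting has all Johnson coefficients equal to `1`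
  (`C(k,2) − c₁·k(m−k) + c₂·C(m−k,2) = (k−1)² − k(k−2) = 1`), using the edge counts `card_filter_edgeVerts_subset`
  (`C(k,2)` inner), `card_filter_edgeVerts_inter_eq_one` (`k(m−k)` boundary), `card_filter_edgeVerts_inter_eq_zero`
  (`C(m−k,2)` outer edges);
* `inner_nonneg_of_johnsonCoeff_nonneg` — master inequality `⟨ω, w⟩ ≥ 0` whenever the coefficients `λ_Q(ω) ≥ 0`;
* `abs_sum_le_of_cliqueNonneg` — **ℓ₁-domination** (stub): `∑_e |w(e)| ≤ (2k² − 4k + 1)·∑_e w(e)`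
  (`ω = 1 − ρ·sgn w`, `ρ = 1/(2k²−4k+1)`: `λ_Q ≥ (1−ρ)(k−1)² − (1+ρ)k(k−2) = 1 − ρ(2k²−4k+1) = 0`). So the negative
  mass of a valid weighting is at most `k(k−2)` times its total, and dually every edge weighting with values in
  `[1−ρ, 1+ρ]` is a non-negative combination of `k`-clique indicators (an `ℓ_∞`-ball of radius `1/(2k²)` around
  the uniform weighting inside the clique cone);
* `neg_entry_le_of_cliqueNonneg` — **entry bound** (stub): `w(e₀) ≥ −((k−2)/(m−k))·∑_e w(e)`
  (`ω = 1 + ((m−k)/(k−2))·𝟙_{e₀}`; tight for the dipole `−𝟙_{ab} + (stars at a, b)/(2(k−2))`).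
[new]
-/

set_option linter.dupNamespace false

namespace Summit.PneNP.PneNP.Theorems

open Finset
open Summit.PneNP.PneNP.Cruxes.ConvexGateBlind.StrictRankConicCover (Edge)

noncomputable section

variable {m : ℕ}

/-! ## The Johnson coefficients: values and counts -/

/-- The number of endpoints of `e` inside `Q` is at most `2`, and equals `2` iff `e ⊆ Q`. [folklore] -/
theorem card_edgeVerts_inter_le (e : Edge m) (Q : Finset (Fin m)) :
    (edgeVerts e ∩ Q).card ≤ 2 ∧ ((edgeVerts e ∩ Q).card = 2 ↔ edgeVerts e ⊆ Q) := by
  refine ⟨(card_le_card inter_subset_left).trans (card_edgeVerts e).le, ?_⟩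
  rw [← card_edgeVerts e]
  constructor
  · intro h
    have := Finset.eq_of_subset_of_card_le inter_subset_left h.ge
    exact fun v hv => (Finset.mem_inter.1 (this.symm ▸ hv)).2
  · intro h
    rw [Finset.inter_eq_left.2 h]

/-- Edges with both endpoints in `Q`: `C(#Q, 2)` of them. [folklore] -/
theorem card_filter_edgeVerts_subset (Q : Finset (Fin m)) :
    ((Finset.univ : Finset (Edge m)).filter (fun e => edgeVerts e ⊆ Q)).card = Q.card.choose 2 := by
  rw [← Literature.Computability.Complexity.card_filter_cliqueVec Q]
  congr 1
  ext e
  simp only [Finset.mem_filter, Finset.mem_univ, true_and, cliqueVec_eq_true_iff_edgeVerts_subset]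

/-- Edges with no endpoint in `Q`: `C(m - #Q, 2)` of them. [folklore] -/
theorem card_filter_edgeVerts_inter_eq_zero (Q : Finset (Fin m)) :
    ((Finset.univ : Finset (Edge m)).filter (fun e => (edgeVerts e ∩ Q).card = 0)).card = (m - Q.card).choose 2 := by
  classical
  have h := card_filter_edgeVerts_subset (m := m) Qᶜ
  rw [Finset.card_compl, Fintype.card_fin] at h
  rw [← h]
  congr 1
  ext e
  simp only [Finset.mem_filter, Finset.mem_univ, true_and, Finset.card_eq_zero,
    ← Finset.disjoint_iff_inter_eq_empty, Finset.subset_compl_iff_disjoint_right]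

/-- **The count of boundary edges.** Edges with exactly one endpoint in a `k`-set `Q` (`k ≤ m`): `k(m-k)` of them,
computed as `C(m,2) − C(k,2) − C(m−k,2)`. [folklore] -/
theorem card_filter_edgeVerts_inter_eq_one {k : ℕ} (Q : Finset (Fin m)) (hQ : Q.card = k) (hkm : k ≤ m) :
    (((Finset.univ : Finset (Edge m)).filter (fun e => (edgeVerts e ∩ Q).card = 1)).card : ℝ) = k * (m - k) := by
  classical
  -- the three intersection sizes partition the edges
  have hpart : ((Finset.univ : Finset (Edge m)).filter (fun e => (edgeVerts e ∩ Q).card = 1)).card +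
      ((Finset.univ : Finset (Edge m)).filter (fun e => edgeVerts e ⊆ Q)).card +
      ((Finset.univ : Finset (Edge m)).filter (fun e => (edgeVerts e ∩ Q).card = 0)).card =
        (Finset.univ : Finset (Edge m)).card := by
    rw [← Finset.card_union_of_disjoint, ← Finset.card_union_of_disjoint]
    · congr 1
      ext e
      simp only [Finset.mem_union, Finset.mem_filter, Finset.mem_univ, true_and, iff_true]
      have h := card_edgeVerts_inter_le e Q
      rcases Nat.lt_or_ge (edgeVerts e ∩ Q).card 2 with hlt | hge
      · rcases Nat.lt_or_ge (edgeVerts e ∩ Q).card 1 with h0 | h1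
        · right; omega
        · left; left; omega
      · left; right; exact h.2.1 (by omega)
    · rw [Finset.disjoint_left]
      intro e he he'
      simp only [Finset.mem_union, Finset.mem_filter, Finset.mem_univ, true_and] at he he'
      rcases he with he | he
      · omega
      · have := (card_edgeVerts_inter_le e Q).2.2 he; omega
    · rw [Finset.disjoint_left]
      intro e he he'
      simp only [Finset.mem_filter, Finset.mem_univ, true_and] at he he'
      have := (card_edgeVerts_inter_le e Q).2.2 he'; omega
  rw [card_filter_edgeVerts_subset, card_filter_edgeVerts_inter_eq_zero, hQ, Finset.card_univ,
    Literature.Computability.Complexity.card_edgeSet_top_fin] at hpart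
  have h' := congrArg (fun n : ℕ => (n : ℝ)) hpart
  push_cast at h'
  rw [Nat.cast_choose_two, Nat.cast_choose_two, Nat.cast_choose_two, Nat.cast_sub hkm] at h'
  linarith

/-- **The uniform certificate.** For a `k`-set `Q` (`4 ≤ k`, `k + 2 ≤ m`): `∑_e g(e,Q) = C(k,2) − c₁·k(m−k) + c₂·C(m−k,2) = 1`,
written with the linear form of `g`. [new] -/
theorem sum_johnsonCoeff_eq_one {k : ℕ} (hm : k + 2 ≤ m) (Q : Finset (Fin m)) (hQ : Q.card = k) :
    ∑ e : Edge m,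
        ((1 + 2 * ((k - 2 : ℝ) / (m - k)) + (k - 1 : ℝ) * (k - 2) / ((m - k) * (m - k - 1))) *
            (if edgeVerts e ⊆ Q then (1 : ℝ) else 0) -
          (((k - 2 : ℝ) / (m - k)) + (k - 1 : ℝ) * (k - 2) / ((m - k) * (m - k - 1))) * ((edgeVerts e ∩ Q).card : ℝ) +
          (k - 1 : ℝ) * (k - 2) / ((m - k) * (m - k - 1))) = 1 := by
  classical
  -- `#(e ∩ Q) = 2·𝟙[e ⊆ Q] + 𝟙[#(e ∩ Q) = 1]`
  have hn : ∀ e : Edge m, ((edgeVerts e ∩ Q).card : ℝ) =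
      2 * (if edgeVerts e ⊆ Q then (1 : ℝ) else 0) + (if (edgeVerts e ∩ Q).card = 1 then (1 : ℝ) else 0) := by
    intro e
    have h := card_edgeVerts_inter_le e Q
    by_cases hs : edgeVerts e ⊆ Q
    · have h2 := h.2.2 hs
      rw [if_pos hs, if_neg (by omega), h2]; norm_num
    · rw [if_neg hs]
      have hne2 : (edgeVerts e ∩ Q).card ≠ 2 := fun h2 => hs (h.2.1 h2)
      by_cases h1 : (edgeVerts e ∩ Q).card = 1
      · rw [if_pos h1, h1]; norm_num
      · rw [if_neg h1]
        have h0 : (edgeVerts e ∩ Q).card = 0 := by omega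
        rw [h0]; norm_num
  simp_rw [hn]
  rw [Finset.sum_add_distrib, Finset.sum_sub_distrib, ← Finset.mul_sum, ← Finset.mul_sum, Finset.sum_const,
    Finset.card_univ, Literature.Computability.Complexity.card_edgeSet_top_fin, nsmul_eq_mul, Finset.sum_add_distrib,
    ← Finset.mul_sum, Finset.sum_boole, Finset.sum_boole, card_filter_edgeVerts_subset, hQ,
    card_filter_edgeVerts_inter_eq_one Q hQ (by omega)]
  rw [Nat.cast_choose_two, Nat.cast_choose_two]
  have hmk : (0 : ℝ) < (m : ℝ) - k := by
    have : ((k : ℝ) + 2 ≤ m) := by exact_mod_cast hm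
    linarith
  have hmk1 : (0 : ℝ) < (m : ℝ) - k - 1 := by
    have : ((k : ℝ) + 2 ≤ m) := by exact_mod_cast hm
    linarith
  field_simp
  ring

/-- **Master inequality.** For `4 ≤ k`, `k + 2 ≤ m`, a `k`-clique-non-negative `w` and any edge function `ω` whose
Johnson coefficients `λ_Q(ω) = ∑_e ω(e) g(e,Q)` are `≥ 0` on all `k`-sets: `∑_e ω(e) w(e) ≥ 0`. [new] -/
theorem inner_nonneg_of_johnsonCoeff_nonneg {k : ℕ} (hk : 4 ≤ k) (hm : k + 2 ≤ m) (ω w : Edge m → ℝ)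
    (hlam : ∀ Q ∈ (Finset.univ : Finset (Fin m)).powersetCard k, 0 ≤ ∑ e : Edge m, ω e *
        ((1 + 2 * ((k - 2 : ℝ) / (m - k)) + (k - 1 : ℝ) * (k - 2) / ((m - k) * (m - k - 1))) *
            (if edgeVerts e ⊆ Q then (1 : ℝ) else 0) -
          (((k - 2 : ℝ) / (m - k)) + (k - 1 : ℝ) * (k - 2) / ((m - k) * (m - k - 1))) * ((edgeVerts e ∩ Q).card : ℝ) +
          (k - 1 : ℝ) * (k - 2) / ((m - k) * (m - k - 1))))
    (hw : ∀ Q ∈ (Finset.univ : Finset (Fin m)).powersetCard k, 0 ≤ softWindow w Q) :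
    0 ≤ ∑ e, ω e * w e :=
  inner_nonneg_of_kernel _ (C := (Nat.choose (m - 2) (k - 2) : ℝ))
    (by exact_mod_cast Nat.choose_pos (by omega)) (fun e f => johnson_kernel_at hk hm e f) ω w hlam hw

/-! ## ℓ₁-domination and the entry bound -/

/-- **ℓ₁-domination of clique-non-negative weightings.** If `4 ≤ k`, `k + 2 ≤ m` and `w(E(Q)) ≥ 0` for every `k`-set `Q`,
then `∑_e |w(e)| ≤ (2k² − 4k + 1) · ∑_e w(e)`: the negative mass of a valid weighting is at most `k(k−2)` times its
total. (Certificate `ω = 1 − ρ·sgn(w)`, `ρ = 1/(2k²−4k+1)`: on a `k`-set `Q` the coefficient is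
`≥ (1−ρ)·1·C(k,2) − (1+ρ)·c₁·k(m−k) + (1−ρ)·c₂·C(m−k,2) = 1 − ρ(2k²−4k+1) = 0`.) Dually: every edge weighting with
values in `[1−ρ, 1+ρ]` is a non-negative combination of `k`-clique indicators. [new] -/
theorem abs_sum_le_of_cliqueNonneg_at {k : ℕ} (hk : 4 ≤ k) (hm : k + 2 ≤ m) (w : Edge m → ℝ)
    (hw : ∀ Q ∈ (Finset.univ : Finset (Fin m)).powersetCard k, 0 ≤ softWindow w Q) :
    ∑ e, |w e| ≤ (2 * (k : ℝ) ^ 2 - 4 * k + 1) * ∑ e, w e := by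
  classical
  set ρ : ℝ := 1 / (2 * (k : ℝ) ^ 2 - 4 * k + 1) with hρ
  have hk' : (4 : ℝ) ≤ k := by exact_mod_cast hk
  have hL : (0 : ℝ) < 2 * (k : ℝ) ^ 2 - 4 * k + 1 := by nlinarith
  have hρpos : 0 < ρ := by rw [hρ]; positivity
  have hρle : ρ ≤ 1 := by
    rw [hρ, div_le_one hL]; nlinarith
  -- the certificate
  set ω : Edge m → ℝ := fun e => 1 - ρ * Real.sign (w e) with hω
  have hωw : ∀ e, ω e * w e = w e - ρ * |w e| := by
    intro e
    rw [hω]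
    simp only
    rcases lt_trichotomy (w e) 0 with h | h | h
    · rw [Real.sign_of_neg h, abs_of_neg h]; ring
    · rw [h]; simp
    · rw [Real.sign_of_pos h, abs_of_pos h]; ring
  have hωb : ∀ e, 1 - ρ ≤ ω e ∧ ω e ≤ 1 + ρ := by
    intro e
    rw [hω]
    simp only
    rcases lt_trichotomy (w e) 0 with h | h | h
    · rw [Real.sign_of_neg h]; constructor <;> linarith
    · rw [h, Real.sign_zero]; constructor <;> linarith
    · rw [Real.sign_of_pos h]; constructor <;> linarith
  have hmk : (0 : ℝ) < (m : ℝ) - k := by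
    have : ((k : ℝ) + 2 ≤ m) := by exact_mod_cast hm
    linarith
  have hmk1 : (0 : ℝ) < (m : ℝ) - k - 1 := by
    have : ((k : ℝ) + 2 ≤ m) := by exact_mod_cast hm
    linarith
  set c₁ : ℝ := (k - 2 : ℝ) / (m - k) with hc₁
  set c₂ : ℝ := (k - 1 : ℝ) * (k - 2) / ((m - k) * (m - k - 1)) with hc₂
  have hc₁0 : 0 ≤ c₁ := by rw [hc₁]; exact div_nonneg (by linarith) hmk.le
  have hc₂0 : 0 ≤ c₂ := by rw [hc₂]; exact div_nonneg (by nlinarith) (by positivity)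
  have key := inner_nonneg_of_johnsonCoeff_nonneg hk hm ω w ?_ hw
  · simp_rw [hωw] at key
    rw [Finset.sum_sub_distrib, ← Finset.mul_sum] at key
    rw [hρ] at key
    rw [div_mul_eq_mul_div, one_mul] at key
    have h1 : (∑ e, |w e|) / (2 * (k : ℝ) ^ 2 - 4 * k + 1) ≤ ∑ e, w e := by linarith [key]
    have h2 := (div_le_iff₀ hL).1 h1
    linarith [h2]
  · intro Q hQ
    rw [Finset.mem_powersetCard] at hQ
    -- pointwise lower bound on `ω(e) g(e,Q)`
    have hpt : ∀ e : Edge m,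
        ((1 - ρ) * (if edgeVerts e ⊆ Q then (1 : ℝ) else 0) - (1 + ρ) * c₁ *
            (if (edgeVerts e ∩ Q).card = 1 then (1 : ℝ) else 0) +
          (1 - ρ) * c₂ * (if (edgeVerts e ∩ Q).card = 0 then (1 : ℝ) else 0)) ≤
        ω e * ((1 + 2 * c₁ + c₂) * (if edgeVerts e ⊆ Q then (1 : ℝ) else 0) -
          (c₁ + c₂) * ((edgeVerts e ∩ Q).card : ℝ) + c₂) := by
      intro e
      have h := card_edgeVerts_inter_le e Q
      obtain ⟨hlo, hhi⟩ := hωb e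
      by_cases hs : edgeVerts e ⊆ Q
      · have h2 := h.2.2 hs
        rw [if_pos hs, if_neg (by omega), if_neg (by omega), h2]
        push_cast
        nlinarith
      · rw [if_neg hs]
        have hne2 : (edgeVerts e ∩ Q).card ≠ 2 := fun h2 => hs (h.2.1 h2)
        by_cases h1 : (edgeVerts e ∩ Q).card = 1
        · rw [if_pos h1, if_neg (by omega), h1]
          push_cast
          nlinarith
        · have h0 : (edgeVerts e ∩ Q).card = 0 := by omega
          rw [if_neg h1, if_pos h0, h0]
          push_cast
          nlinarith
    refine le_trans ?_ (Finset.sum_le_sum fun e _ => hpt e)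
    rw [Finset.sum_add_distrib, Finset.sum_sub_distrib, ← Finset.mul_sum, ← Finset.mul_sum, ← Finset.mul_sum,
      Finset.sum_boole, Finset.sum_boole, Finset.sum_boole, card_filter_edgeVerts_subset, hQ.2,
      card_filter_edgeVerts_inter_eq_one Q hQ.2 (by omega), card_filter_edgeVerts_inter_eq_zero, hQ.2,
      Nat.cast_choose_two, Nat.cast_choose_two, Nat.cast_sub (by omega : k ≤ m)]
    -- the numerical inequality `(1−ρ)(k−1)² − (1+ρ)k(k−2) ≥ 0`
    have hx1 : c₁ * ((k : ℝ) * ((m : ℝ) - k)) = (k : ℝ) * (k - 2) := by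
      rw [hc₁]; field_simp
    have hx2 : c₂ * (((m : ℝ) - k) * ((m : ℝ) - k - 1) / 2) = ((k : ℝ) - 1) * (k - 2) / 2 := by
      rw [hc₂]; field_simp
    have hρL : ρ * (2 * (k : ℝ) ^ 2 - 4 * k + 1) = 1 := by rw [hρ, one_div, inv_mul_cancel₀ hL.ne']
    nlinarith [hx1, hx2, hρL, hc₁0, hc₂0, hρpos, hρle]

/-- **Entry bound.** If `4 ≤ k`, `k + 2 ≤ m` and `w(E(Q)) ≥ 0` for every `k`-set `Q`, then for every edge `e₀`:
`−((k−2)/(m−k)) · ∑_e w(e) ≤ w(e₀)` — a valid weighting has no entry below `−(k−2)/(m−k)` times its total.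
(Certificate `ω = 1 + ((m−k)/(k−2))·𝟙_{e₀}`: `λ_Q(ω) = 1 + ((m−k)/(k−2))·g(e₀,Q) ≥ 1 − ((m−k)/(k−2))·c₁ = 0`.) [new] -/
theorem neg_entry_le_of_cliqueNonneg_at {k : ℕ} (hk : 4 ≤ k) (hm : k + 2 ≤ m) (w : Edge m → ℝ)
    (hw : ∀ Q ∈ (Finset.univ : Finset (Fin m)).powersetCard k, 0 ≤ softWindow w Q) (e₀ : Edge m) :
    -(((k : ℝ) - 2) / ((m : ℝ) - k)) * ∑ e, w e ≤ w e₀ := by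
  classical
  have hmk : (0 : ℝ) < (m : ℝ) - k := by
    have : ((k : ℝ) + 2 ≤ m) := by exact_mod_cast hm
    linarith
  have hmk1 : (0 : ℝ) < (m : ℝ) - k - 1 := by
    have : ((k : ℝ) + 2 ≤ m) := by exact_mod_cast hm
    linarith
  have hk2 : (0 : ℝ) < (k : ℝ) - 2 := by
    have : (4 : ℝ) ≤ k := by exact_mod_cast hk
    linarith
  set Mu : ℝ := ((m : ℝ) - k) / ((k : ℝ) - 2) with hMu
  have hMu0 : 0 ≤ Mu := by rw [hMu]; positivity
  set ω : Edge m → ℝ := fun e => 1 + Mu * (if e = e₀ then 1 else 0) with hω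
  have key := inner_nonneg_of_johnsonCoeff_nonneg hk hm ω w ?_ hw
  · have hsplit : ∑ e, ω e * w e = ∑ e, w e + Mu * w e₀ := by
      rw [hω]
      simp only [add_mul, one_mul, Finset.sum_add_distrib, mul_assoc, ← Finset.mul_sum]
      congr 1
      rw [Finset.sum_eq_single e₀]
      · simp
      · intro e _ he; rw [if_neg he]; ring
      · intro h; exact absurd (Finset.mem_univ e₀) h
    rw [hsplit] at key
    -- `w e₀ ≥ -(∑ w)/Mu = -((k-2)/(m-k)) ∑ w`
    have hMupos : 0 < Mu := by rw [hMu]; positivity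
    have hinv : ((k : ℝ) - 2) / ((m : ℝ) - k) = Mu⁻¹ := by rw [hMu, inv_div]
    rw [hinv, show -Mu⁻¹ * ∑ e, w e = (-(∑ e, w e)) / Mu by ring, div_le_iff₀ hMupos]
    linarith [key]
  · intro Q hQ
    rw [Finset.mem_powersetCard] at hQ
    set c₁ : ℝ := (k - 2 : ℝ) / (m - k) with hc₁
    set c₂ : ℝ := (k - 1 : ℝ) * (k - 2) / ((m - k) * (m - k - 1)) with hc₂
    have hc₁0 : 0 ≤ c₁ := by rw [hc₁]; exact div_nonneg (by linarith) hmk.le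
    have hc₂0 : 0 ≤ c₂ := by rw [hc₂]; exact div_nonneg (by nlinarith) (by positivity)
    have hone := sum_johnsonCoeff_eq_one hm Q hQ.2
    -- split `ω = 1 + Mu·δ_{e₀}`
    have hsplit : ∀ e : Edge m, ω e * ((1 + 2 * c₁ + c₂) * (if edgeVerts e ⊆ Q then (1 : ℝ) else 0) -
          (c₁ + c₂) * ((edgeVerts e ∩ Q).card : ℝ) + c₂) =
        ((1 + 2 * c₁ + c₂) * (if edgeVerts e ⊆ Q then (1 : ℝ) else 0) -
          (c₁ + c₂) * ((edgeVerts e ∩ Q).card : ℝ) + c₂) +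
        Mu * (if e = e₀ then ((1 + 2 * c₁ + c₂) * (if edgeVerts e ⊆ Q then (1 : ℝ) else 0) -
          (c₁ + c₂) * ((edgeVerts e ∩ Q).card : ℝ) + c₂) else 0) := by
      intro e; rw [hω]; simp only; split_ifs <;> ring
    simp_rw [hsplit]
    rw [Finset.sum_add_distrib, hone, ← Finset.mul_sum, Finset.sum_ite_eq' Finset.univ e₀, if_pos (Finset.mem_univ _)]
    -- `g(e₀,Q) ≥ -c₁` and `Mu * c₁ = 1`
    have hg : -c₁ ≤ (1 + 2 * c₁ + c₂) * (if edgeVerts e₀ ⊆ Q then (1 : ℝ) else 0) -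
        (c₁ + c₂) * ((edgeVerts e₀ ∩ Q).card : ℝ) + c₂ := by
      have h := card_edgeVerts_inter_le e₀ Q
      by_cases hs : edgeVerts e₀ ⊆ Q
      · rw [if_pos hs, h.2.2 hs]; push_cast; nlinarith
      · rw [if_neg hs]
        have hne2 : (edgeVerts e₀ ∩ Q).card ≠ 2 := fun h2 => hs (h.2.1 h2)
        have hle : ((edgeVerts e₀ ∩ Q).card : ℝ) ≤ 1 := by
          have : (edgeVerts e₀ ∩ Q).card ≤ 1 := by omega
          exact_mod_cast this
        have hge : (0 : ℝ) ≤ ((edgeVerts e₀ ∩ Q).card : ℝ) := by positivity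
        nlinarith
    have hMuc : Mu * c₁ = 1 := by rw [hMu, hc₁]; field_simp
    nlinarith [hg, hMuc, hMu0]

/-- **ℓ₁-domination** (registered form of `abs_sum_le_of_cliqueNonneg_at`): for `4 ≤ k`, `k + 2 ≤ m` and a
`k`-clique-non-negative edge weighting `w` of `K_m`, `∑_e |w(e)| ≤ (2k² − 4k + 1)·∑_e w(e)`. [new] -/
theorem abs_sum_le_of_cliqueNonneg : ∀ {m k : ℕ}, 4 ≤ k → k + 2 ≤ m → ∀ (w : Edge m → ℝ), (∀ Q ∈ (Finset.univ : Finset (Fin m)).powersetCard k, 0 ≤ softWindow w Q) → ∑ e, |w e| ≤ (2 * (k : ℝ) ^ 2 - 4 * k + 1) * ∑ e, w e :=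
  fun hk hm w hw => abs_sum_le_of_cliqueNonneg_at hk hm w hw

/-- **Entry bound** (registered form of `neg_entry_le_of_cliqueNonneg_at`): for `4 ≤ k`, `k + 2 ≤ m` and a
`k`-clique-non-negative `w`, every entry satisfies `w(e₀) ≥ −((k−2)/(m−k))·∑_e w(e)`. [new] -/
theorem neg_entry_le_of_cliqueNonneg : ∀ {m k : ℕ}, 4 ≤ k → k + 2 ≤ m → ∀ (w : Edge m → ℝ), (∀ Q ∈ (Finset.univ : Finset (Fin m)).powersetCard k, 0 ≤ softWindow w Q) → ∀ (e₀ : Edge m), -(((k : ℝ) - 2) / ((m : ℝ) - k)) * ∑ e, w e ≤ w e₀ :=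
  fun hk hm w hw e₀ => neg_entry_le_of_cliqueNonneg_at hk hm w hw e₀

end

end Summit.PneNP.PneNP.Theorems
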